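import Mathlib
import HarnessLib
import Summits.HubbardSuperconductivity.HubbardSuperconductivity.Theorems.ChiralWindowCwKLChiralWindowBlockBoundsX

/-!
# Crux `CwChiralConstruction` (stmt-HubbardSuperconductivity-1740), line `ladder-scale-transfer` rev c7-1:
# stub (P2) `stub_pointLeadingOfBox` — certificate logic for ONE Kohn–Luttinger box

Route `HubbardSuperconductivity/ChiralWindow`, rank-2 crux. Support file (`--supports stmt-HubbardSuperconductivity-1740`).

Write `ε₀ = squareDispersion 1 0` and `Λ₁(μ, χ) = channelInf ε₀ μ 1 χ` (bottom of the second-order pairing vertex over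
the normalised gap functions of the `D₄` irrep `χ` on the level-`μ` Fermi curve at `U = 1`).

This is the pure certificate LOGIC for one box `bx : KLBox` of a Kohn–Luttinger record in the vocabulary of crux
stmt-1741 (`Theorems/ChiralWindowDefs.lean`, `…DefsEx.lean`, `…DefsResidual.lean`): if the box ends lie in `(-4, 0)`,
the `B1g` block passes the `E_x`-form Temple test `templeOKX`, the four other blocks pass `lowerOKX`, and the rational
test `b1gLeadsOKX tab γ` holds (`upper_B1g + γ ≤ lowerX_χ` for the four `χ ≠ B1g`), then at every level `μ` of the box
where the residual-form block enclosures hold, `Λ₁(μ, B1g) + γ ≤ Λ₁(μ, χ)` for every `χ ≠ B1g`.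

All the analysis is in the LANDED block-level soundness theorem `stub_klBlockBoundsX`
(`Theorems/ChiralWindowCwKLChiralWindowBlockBoundsX.lean`): `lowerX_χ ≤ Λ₁(μ, χ)` under `lowerOKX`, and
`Λ₁(μ, χ) ≤ upper_χ` under `templeOKX` in the equality case `withU ∨ χ ≠ A1g` (Ritz / Temple, Reed–Simon IV Thm. XIII.5).
Here we only chain these real inequalities with the rational test. Model: `klcx_box_bounds` and clause N1 of
`stub_klCertNumericalX` in `Theorems/ChiralWindowCwKLChiralWindowCertNumericalX.lean`.

No definitions; everything is proved.
-/

noncomputable section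

namespace Summit.HubbardSuperconductivity.HubbardSuperconductivity.Theorems
set_option linter.dupNamespace false

open MeasureTheory Literature.MathematicalPhysics.QuantumLattice CwKLChiralWindow

/-- **Certificate logic for ONE box** (stub (P2) of crux stmt-1740, record-generic). For a box `bx` with table `tab`
whose ends lie in `(-4, 0)`, whose `B1g` block passes the `E_x`-form Temple test, whose four other blocks each pass
`lowerOKX` (Temple data on a trial block or far-channel data on a block without trial) and which passes the rational
test `b1gLeadsOKX tab γ` (`upper_B1g + γ ≤ lowerX_χ` for the four `χ ≠ B1g`): at every level `μ` of the box where the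
residual-form block enclosures E1–E4 hold, `Λ₁(μ, B1g) + γ ≤ Λ₁(μ, χ)` for every `χ ≠ B1g`. Proof:
`stub_klBlockBoundsX` gives `Λ₁(μ, B1g) ≤ upper_B1g` (Ritz, case `B1g ≠ A1g`) and `lowerX_χ ≤ Λ₁(μ, χ)`; chain with the
rational test. [cite: ReedSimonIV1978, Thm. XIII.5] -/
theorem stub_pointLeadingOfBox :
    ∀ (bx : KLBox) (tab : List KLTrig) (γ : ℚ), -4 < bx.mulo → bx.muhi < 0 →
      bx.bB1g.templeOKX tab D4Irrep.B1g = true →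
      bx.bA1g.lowerOKX tab D4Irrep.A1g = true → bx.bA2g.lowerOKX tab D4Irrep.A2g = true →
      bx.bB2g.lowerOKX tab D4Irrep.B2g = true → bx.bE.lowerOKX tab D4Irrep.E = true →
      bx.b1gLeadsOKX tab γ = true →
      ∀ μ ∈ Set.Icc ((bx.mulo : ℚ) : ℝ) ((bx.muhi : ℚ) : ℝ), (∀ χ : D4Irrep, (bx.blk χ).EnclosureR tab μ χ) →
        ∀ χ : D4Irrep, χ ≠ D4Irrep.B1g →
          channelInf (squareDispersion 1 0) μ 1 D4Irrep.B1g + ((γ : ℚ) : ℝ) ≤ channelInf (squareDispersion 1 0) μ 1 χ := by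
  intro bx tab γ h4 h0 htB hA1 hA2 hB2 hE hlead μ hμ hencl χ hχ
  have h4' : (-4 : ℝ) < ((bx.mulo : ℚ) : ℝ) := by exact_mod_cast h4
  have h0' : ((bx.muhi : ℚ) : ℝ) < 0 := by exact_mod_cast h0
  have hμ' : μ ∈ Set.Ioo (-4 : ℝ) 0 := ⟨h4'.trans_le hμ.1, hμ.2.trans_lt h0'⟩
  -- Ritz upper bound for the `B1g` trial block (equality case `B1g ≠ A1g`)
  have hEB : bx.bB1g.EnclosureR tab μ D4Irrep.B1g := hencl D4Irrep.B1g
  have hupB : channelInf (squareDispersion 1 0) μ 1 D4Irrep.B1g ≤ ((bx.bB1g.upper : ℚ) : ℝ) :=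
    (stub_klBlockBoundsX μ hμ' bx.bB1g tab D4Irrep.B1g hEB).2 htB (Or.inr (by decide))
  -- the rational test, unpacked
  have hl : bx.bB1g.upper + γ ≤ bx.bA1g.lowerX tab .A1g ∧ bx.bB1g.upper + γ ≤ bx.bA2g.lowerX tab .A2g ∧
      bx.bB1g.upper + γ ≤ bx.bB2g.lowerX tab .B2g ∧ bx.bB1g.upper + γ ≤ bx.bE.lowerX tab .E := by
    simpa only [KLBox.b1gLeadsOKX, Bool.and_eq_true, decide_eq_true_eq, and_assoc] using hlead
  obtain ⟨hlA1, hlA2, hlB2, hlE⟩ := hl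
  cases χ with
  | A1g =>
    have hEA : bx.bA1g.EnclosureR tab μ D4Irrep.A1g := hencl D4Irrep.A1g
    calc channelInf (squareDispersion 1 0) μ 1 D4Irrep.B1g + ((γ : ℚ) : ℝ)
        ≤ ((bx.bB1g.upper : ℚ) : ℝ) + ((γ : ℚ) : ℝ) := add_le_add hupB le_rfl
      _ ≤ ((bx.bA1g.lowerX tab .A1g : ℚ) : ℝ) := by exact_mod_cast hlA1
      _ ≤ _ := (stub_klBlockBoundsX μ hμ' bx.bA1g tab D4Irrep.A1g hEA).1 hA1
  | A2g =>
    have hEA : bx.bA2g.EnclosureR tab μ D4Irrep.A2g := hencl D4Irrep.A2g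
    calc channelInf (squareDispersion 1 0) μ 1 D4Irrep.B1g + ((γ : ℚ) : ℝ)
        ≤ ((bx.bB1g.upper : ℚ) : ℝ) + ((γ : ℚ) : ℝ) := add_le_add hupB le_rfl
      _ ≤ ((bx.bA2g.lowerX tab .A2g : ℚ) : ℝ) := by exact_mod_cast hlA2
      _ ≤ _ := (stub_klBlockBoundsX μ hμ' bx.bA2g tab D4Irrep.A2g hEA).1 hA2
  | B1g => exact absurd rfl hχ
  | B2g =>
    have hEA : bx.bB2g.EnclosureR tab μ D4Irrep.B2g := hencl D4Irrep.B2g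
    calc channelInf (squareDispersion 1 0) μ 1 D4Irrep.B1g + ((γ : ℚ) : ℝ)
        ≤ ((bx.bB1g.upper : ℚ) : ℝ) + ((γ : ℚ) : ℝ) := add_le_add hupB le_rfl
      _ ≤ ((bx.bB2g.lowerX tab .B2g : ℚ) : ℝ) := by exact_mod_cast hlB2
      _ ≤ _ := (stub_klBlockBoundsX μ hμ' bx.bB2g tab D4Irrep.B2g hEA).1 hB2
  | E =>
    have hEA : bx.bE.EnclosureR tab μ D4Irrep.E := hencl D4Irrep.E
    calc channelInf (squareDispersion 1 0) μ 1 D4Irrep.B1g + ((γ : ℚ) : ℝ)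
        ≤ ((bx.bB1g.upper : ℚ) : ℝ) + ((γ : ℚ) : ℝ) := add_le_add hupB le_rfl
      _ ≤ ((bx.bE.lowerX tab .E : ℚ) : ℝ) := by exact_mod_cast hlE
      _ ≤ _ := (stub_klBlockBoundsX μ hμ' bx.bE tab D4Irrep.E hEA).1 hE

end Summit.HubbardSuperconductivity.HubbardSuperconductivity.Theorems

end
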